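import Mathlib

/-!
# Solo-informed s18: bookkeeping behind the Kummer-character certificate of `msfast.gp`

Part II §7.11 (9″) evaluates the unit Steinberg symbol `{ε₁, ε₂} mod 5` of a totally real cubic
field as a McCallum–Sharifi pairing value.  The norm equation `ε₂ = N(ξ)` in the degree-30
Kummer field is solved only *modulo* `⟨ε₁⟩ · (K^×)^5`, by linear algebra over `𝔽₅` on
`S`-units, and certified by a family of Kummer characters (linear functionals on
`V = O_{K,S}^× ⊗ 𝔽₅`).  Two pieces of pure bookkeeping make this legitimate:

* `soloInformed_kernel_certificate`: if the sampled functionals have a common kernel of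
  dimension one containing the non-zero class of `ε₁`, then any class they all kill (here
  `ε₂ / N(y)`) is a multiple of `ε₁` — so `ε₂ = N(y) · ε₁^j · b₀^5` exactly;
* `soloInformed_moment_shift_invariant`: the orbit moment `∑ j·c_j` over `ℤ/5` is unchanged
  when all five exponents are shifted by the same constant (the unknown `v_𝔮(b₀)`), because
  `0+1+2+3+4 = 10 ≡ 0 (mod 5)` — so the moments of `ξ = y α^j / b₀` are those of `y`.

together with the rank–nullity step that turns "rank `= dim V − 1`" into "kernel of dimension 1".
No number theory is formalised here; these are the identities the GP script relies on.
-/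

namespace Summit.Langlands.Langlands.Theorems

open Module Submodule

/-- `0 + 1 + 2 + 3 + 4 = 0` in `ZMod 5`. -/
theorem soloInformed_sum_fin5_cast_zmod5 : (∑ j : Fin 5, ((j : ℕ) : ZMod 5)) = 0 := by
  decide

/-- Shift invariance of the first moment over `ZMod 5`: adding the same constant `s` to all five
exponents `c j` does not change `∑ j, j * c j`. -/
theorem soloInformed_moment_shift_invariant (c : Fin 5 → ZMod 5) (s : ZMod 5) :
    (∑ j : Fin 5, ((j : ℕ) : ZMod 5) * (c j + s)) = ∑ j : Fin 5, ((j : ℕ) : ZMod 5) * c j := by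
  simp only [mul_add, Finset.sum_add_distrib, ← Finset.sum_mul, soloInformed_sum_fin5_cast_zmod5,
    zero_mul, add_zero]

/-- The kernel certificate: in a submodule `W` of dimension one (the common kernel of the sampled
Kummer characters), every element `c` is a scalar multiple of any non-zero element `v` (the class
of `ε₁`). -/
theorem soloInformed_kernel_certificate {K V : Type*} [Field K] [AddCommGroup V] [Module K V]
    {W : Submodule K V} (hW : finrank K W = 1) {v c : V} (hv : v ∈ W) (hv0 : v ≠ 0)
    (hc : c ∈ W) : ∃ a : K, a • v = c := by
  have hspan : W = K ∙ v := eq_span_singleton_of_mem_of_finrank_eq_one hW hv hv0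
  rw [hspan] at hc
  exact mem_span_singleton.1 hc

/-- Rank–nullity in the form used by the script: if the character map `Φ : V → W'` on the
`n`-dimensional space `V` has rank `n - 1` (with `n ≥ 1`), its kernel has dimension one. -/
theorem soloInformed_ker_finrank_eq_one {K V W' : Type*} [Field K] [AddCommGroup V] [Module K V]
    [AddCommGroup W'] [Module K W'] [FiniteDimensional K V] (Φ : V →ₗ[K] W') {n : ℕ}
    (hn : finrank K V = n) (hn1 : 1 ≤ n) (hr : finrank K (LinearMap.range Φ) = n - 1) :
    finrank K (LinearMap.ker Φ) = 1 := by
  have h := LinearMap.finrank_range_add_finrank_ker Φ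
  omega

/-- The two steps combined, as used by `msfast.gp`: characters `Φ` of rank `dim V - 1`, all
vanishing on `v ≠ 0` (the class of `ε₁`) and on `c` (the class of `ε₂ / N(y)`), force `c ∈ ⟨v⟩`. -/
theorem soloInformed_kummer_certificate {K V W' : Type*} [Field K] [AddCommGroup V] [Module K V]
    [AddCommGroup W'] [Module K W'] [FiniteDimensional K V] (Φ : V →ₗ[K] W') {n : ℕ}
    (hn : finrank K V = n) (hn1 : 1 ≤ n) (hr : finrank K (LinearMap.range Φ) = n - 1)
    {v c : V} (hv : Φ v = 0) (hv0 : v ≠ 0) (hc : Φ c = 0) : ∃ a : K, a • v = c :=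
  soloInformed_kernel_certificate (soloInformed_ker_finrank_eq_one Φ hn hn1 hr)
    (LinearMap.mem_ker.2 hv) hv0 (LinearMap.mem_ker.2 hc)

end Summit.Langlands.Langlands.Theorems
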